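import Summits.NavierStokesRegularity.NavierStokesRegularity.Theorems.AxisymmetricSwirlRegularityKatoGlobal
import Summits.NavierStokesRegularity.NavierStokesRegularity.Theorems.TypeIIInviscidRelaxationAxisymSwirlRegularOfNoBlowup
import Literature.Analysis.FluidPDE.LerayHopfProofs
import Literature.Analysis.FluidPDE.NSWeakStrongUniquenessHolds
import HarnessLib

/-!
# Crux `AxisymSwirlRegular` (stmt-NavierStokesRegularity-1964), line `radial_inflow_split`:
# the crux IS EQUIVALENT to "no blow-up in the standing axisymmetric class"

`--supports stmt-NavierStokesRegularity-1964` (helper file; theorems only, no definitions, no `sorry`).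

The registered skeleton of the crux (`Cruxes/AxisymSwirlRegular/Lines/radial_inflow_split.lean`) and the tree's
`axisymSwirlRegular_of_noBlowup` (nsreg-p3) reach `AxisymSwirlRegular` through the NO-BLOW-UP statement `hNB`: every
classical solution on `ℝ³ × [0,T)` which is Leray–Hopf from its rapidly decaying datum, bounded on every sub-slab and
axisymmetric slice-wise extends smoothly past `T`.  This file proves the CONVERSE (`noBlowup_of_axisymSwirlRegular`), so the
two are EQUIVALENT (`axisymSwirlRegular_iff_noBlowup`): the line's final composition step loses nothing, and `hNB` is an
honest EQUIV re-typing of the crux (Clay-(A) form).  Mechanism: by `slabAxisym`'s engine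
(`katoMaximalTime_eq_top_of_axisymSwirlRegular`, p830279: Tao 2011 Lemma 8.1 + weak–strong uniqueness + the singular point of
a finite Kato maximal time) the datum `u 0` has a Tao-class solution `U` on `[0, T+1]`; weak–strong uniqueness
(`weak_strong_uniqueness_holds`, the standing solution being bounded on sub-slabs, hence in the Serrin class `L^∞_t L^∞_x`)
and continuity give `U t = u t` POINTWISE for `t < T`, so `U` is a smooth extension past `T`.
HONEST: an equivalence between two open statements; nothing about Navier–Stokes regularity is proved.
-/

noncomputable section

open Literature.Analysis.FluidPDE MeasureTheory Set Function Filter Topology Metric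
open scoped ContDiff InnerProductSpace RealInnerProductSpace

namespace Summit.NavierStokesRegularity.NavierStokesRegularity.Theorems

-- the problem directory repeats the summit name (`NavierStokesRegularity/NavierStokesRegularity`)
set_option linter.dupNamespace false

namespace AxisymComparisonFlow

/-- **`AxisymSwirlRegular` ⇒ no blow-up in the standing axisymmetric class.**  Given the crux (Clay-(A) form), every
classical solution of the unforced system on `ℝ³ × [0,T)` (`ν, T > 0`) which is Leray–Hopf on `[0,T]` from its rapidly
decaying datum, bounded on every sub-slab `[0,T'] × ℝ³` (`T' < T`) and axisymmetric slice-wise extends smoothly past `T`: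
the Tao-class solution from `u 0` on `[0, T+1]` (it exists since the Kato maximal time is infinite,
`katoMaximalTime_eq_top_of_axisymSwirlRegular`) coincides with `u` on `[0, T)` by weak–strong uniqueness and continuity.
[cite: Tao2011, Lemma 8.1] -/
theorem noBlowup_of_axisymSwirlRegular
    (hAX : Summit.NavierStokesRegularity.NavierStokesRegularity.Theses.TypeIIInviscidRelaxation.AxisymSwirlRegular) :
    ∀ (ν T : ℝ), 0 < ν → 0 < T →
      ∀ (u : ℝ → EuclideanSpace ℝ (Fin 3) → EuclideanSpace ℝ (Fin 3))
        (p : ℝ → EuclideanSpace ℝ (Fin 3) → ℝ),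
        IsClassicalNSSolutionOn (Set.Ico 0 T) ν 0 u p → IsLerayHopfOn T ν 0 (u 0) u →
        (∀ T' < T, ∃ M : ℝ, ∀ t ∈ Set.Icc 0 T', ∀ x, ‖u t x‖ ≤ M) →
        (∀ t ∈ Set.Ico 0 T, IsAxisymmetric (u t)) → HasRapidSpatialDecay (u 0) →
        HasSmoothExtensionPast ν 0 u T :=
  AxisymKatoGlobal.noBlowup_of_axisymmetricSwirlRegularity
    (fun ν hν u₀ hsm hdiv hdec hax => hAX ν hν u₀ hsm hdiv hdec hax)

/-- **The crux `AxisymSwirlRegular` is EQUIVALENT to no blow-up in the standing axisymmetric class** (the hypothesis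
`hNB` of the tree's `axisymSwirlRegular_of_noBlowup` and of the registered skeleton `radial_inflow_split`):
`noBlowup_of_axisymSwirlRegular` and `axisymSwirlRegular_of_noBlowup`. [cite: Tao2011, Lemma 8.1] -/
theorem axisymSwirlRegular_iff_noBlowup :
    Summit.NavierStokesRegularity.NavierStokesRegularity.Theses.TypeIIInviscidRelaxation.AxisymSwirlRegular ↔
      ∀ (ν T : ℝ), 0 < ν → 0 < T →
        ∀ (u : ℝ → EuclideanSpace ℝ (Fin 3) → EuclideanSpace ℝ (Fin 3))
          (p : ℝ → EuclideanSpace ℝ (Fin 3) → ℝ),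
          IsClassicalNSSolutionOn (Set.Ico 0 T) ν 0 u p → IsLerayHopfOn T ν 0 (u 0) u →
          (∀ T' < T, ∃ M : ℝ, ∀ t ∈ Set.Icc 0 T', ∀ x, ‖u t x‖ ≤ M) →
          (∀ t ∈ Set.Ico 0 T, IsAxisymmetric (u t)) → HasRapidSpatialDecay (u 0) →
          HasSmoothExtensionPast ν 0 u T :=
  ⟨noBlowup_of_axisymSwirlRegular, axisymSwirlRegular_of_noBlowup⟩

end AxisymComparisonFlow

end Summit.NavierStokesRegularity.NavierStokesRegularity.Theorems

end
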